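import Literature.Algebra.EuclideanLattices.MRGIVPLoop
import Literature.Algebra.EuclideanLattices.MRGapCVPBlocks
import Literature.Algebra.EuclideanLattices.MRVerifierSoundness
import HarnessLib

/-!
# The idealised reduction of MR07 Thm. 5.23 (`GapCVP′_γ` from an `SIS′` oracle, `γ = 14π√n β`) and its correctness — proved

Topic `Algebra/EuclideanLattices` (family `pqc`). Micciancio–Regev 2007, Thm. 5.23 (authors' version
pp. 28–31): on input a `GapCVP′` instance `(B, t, d)`, the reduction (1) runs the `GIVP` loop of
Cor. 5.13 on the dual lattice with the oracle, obtaining short independent dual vectors `S`;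
(2)–(3) runs `W(B, S)` in `N` blocks until each block yields a witness; (4) answers NO iff the
verifier of Lemma 5.22 accepts the witnesses. This file defines that process as a `PMF Bool`
over the idealised primitives (`loopStep`, `wRun`) — every randomized primitive sampled exactly, and
every test performed by the process computable from what the algorithm sees (the loop's stop flag and
the linear independence of `S`; the shortness of `S` is NOT tested, exactly as in MR07, and enters
only the analysis) — and proves its correctness:

* `wRunS`, `witnesses`, `reduction` (definitions with bodies; `reduction` tests only the stop flag
  and the independence of `S`);
* `not_accepts_of_infDist_le`, `reduction_apply_true_eq_zero` — **YES instances are never called NO**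
  (`dist(t, L) ≤ d` ⇒ `Pr[verdict = NO] = 0`, by `MRVerifierSoundness`);
* `toReal_witnesses_not_accepts_le` — for a short independent dual set `S`, the witnesses of a NO
  instance are rejected with probability `≤ N(1 − (δ′ − 2mε/(1+ε)))^k + e^{−N(1/2−2·2⁻ⁿ)²/2} +
  e^{−N/(nm)²}(4√n·nm)ⁿ + N·m(1+ε)/(1−ε)2⁻ⁿ` (`ε = 2⁻ⁿ`, `δ′` the oracle's `SIS′` success);
* `toReal_reduction_false_le` — **NO instances** (`λ₁(L) > γd`, `dist(kt, L) > γd` for odd `k`):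
  `Pr[verdict = YES] ≤ (T+1)(1−p)^{k₀} +` the above, with `p` the per-round success of Cor. 5.13.

What is NOT here (the remaining, non-mathematical part of [cite: MicciancioRegev2007, Thm. 5.23]):
realising `loopStep`/`wRun` on a probabilistic oracle Turing machine within negligible statistical
distance in polynomial time, and the asymptotic choice of `(T, k₀, N, k)` making the total error
`≤ 1/3` (`GapSVPToSISErrorBudget`).

## References

* D. Micciancio, O. Regev, *Worst-case to average-case reductions based on Gaussian measures*,
  SIAM J. Comput. 37 (2007) 267–302; authors' version, Thm. 5.23 and its proof, pp. 28–31.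
-/

noncomputable section

open Finset Module Submodule

namespace Literature.Algebra.EuclideanLattices

namespace MicciancioRegev2007

section Reduction

open scoped ENNReal Classical Real InnerProductSpace
open MeasureTheory Metric PMF Literature.Probability.Distributions Literature.Computability.Cryptography
  Literature.Computability.Cryptography.SIS

variable {V : Type*} [NormedAddCommGroup V] [InnerProductSpace ℝ V] [FiniteDimensional ℝ V]
  [MeasurableSpace V] [BorelSpace V]
variable (L : Submodule ℤ V) [DiscreteTopology L] [IsZLattice ℝ L]
variable {n : ℕ} [NeZero n] (hn : n = finrank ℝ V)
variable (q : ℕ) [NeZero q] {m : ℕ} (O : Matrix (Fin n) (Fin m) (ZMod q) → PMF (Fin m → ℤ))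

/-- **One run of `W(B, S)`** on the fine grid of `L*` chosen from the independent dual set `S`
(`MRFineGridChoice`) with denominator `d`: `wRun` on `(gridBasis, q, d)`.
[cite: MicciancioRegev2007, Thm. 5.23 (proof, step (2), p. 29)] -/
def wRunS (S : Fin n → dualLattice L) (hS : LinearIndependent ℝ fun j => (S j : V)) (d : ℕ) [NeZero d]
    (s β : ℝ) : PMF (Option (dualLattice L)) :=
  wRun (gridBasis (dualLattice L) S hS hn (q * d)) q d (dualLattice L)
    (Function.surjInv (gridClass_surjective (gridBasis (dualLattice L) S hS hn (q * d)) (q * d)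
      (dualLattice L)))
    (smul_gridBasis_mem (dualLattice L) S hS hn (q * d)) (Function.surjInv_eq _) O s β

/-- **The witnesses**: `N` blocks of `k` runs of `W(B, S)`, each block read through its first
success (MR07 step (3): "let `w₁, …, w_N` be the first `N` successful outputs").
[cite: MicciancioRegev2007, Thm. 5.23 (proof, step (3), p. 29)] -/
def witnesses (S : Fin n → dualLattice L) (hS : LinearIndependent ℝ fun j => (S j : V)) (d : ℕ)
    [NeZero d] (s β : ℝ) (N k : ℕ) : PMF (Fin N → Option (dualLattice L)) :=
  indepLaw N fun _ =>
    (indepLaw k fun _ => wRunS L hn q O S hS d s β).map fun v => (List.ofFn v).findSome? id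

/-- **The idealised reduction of MR07 Thm. 5.23** (verdict `true` = "NO instance"): the loop of
Lemma 5.10 on the dual lattice from `S₀` for `T + 1` rounds (Cor. 5.13); if it has not stopped with an
independent set `S` (the only information the algorithm has about `S`), answer YES; otherwise — whatever
the length of `S`, as in MR07, which uses the output of Cor. 5.13 as is — generate the witnesses with
Gaussian parameter `s = 2√n/(γd)`, `γ = 14π√nβ`, and answer NO iff the verifier accepts.
[cite: MicciancioRegev2007, Thm. 5.23 (the reduction, pp. 28–29)] -/
def reduction (t : V) (dd β : ℝ) (S₀ : Fin n → dualLattice L) (T k₀ N k : ℕ) : PMF Bool :=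
  ((fun ν : PMF (ℕ × Bool × (Fin n → dualLattice L)) =>
      ν.bind (loopStep (dualLattice L) hn q O β k₀))^[T + 1] (PMF.pure (0, true, S₀))).bind
    fun st =>
      if h : st.2.1 = false ∧ LinearIndependent ℝ (fun j => (st.2.2 j : V)) then
        haveI : NeZero (gridDenom (dualLattice L) hn st.2.2 h.2) :=
          ⟨(gridDenom_spec (dualLattice L) hn st.2.2 h.2).1⟩
        (witnesses L hn q O st.2.2 h.2 (gridDenom (dualLattice L) hn st.2.2 h.2)
            (2 * Real.sqrt (finrank ℝ V) / (14 * π * Real.sqrt (finrank ℝ V) * β * dd)) β N k).map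
          fun o => decide (accepts L t dd o)
      else PMF.pure false

/-! ### YES instances: the reduction never says NO -/

omit [MeasurableSpace V] [BorelSpace V] [IsZLattice ℝ L] in
/-- **Soundness: close targets are never accepted** (MR07 p. 29: "`V` outputs No whenever
`dist(t, L(B)) ≤ d`"). [cite: MicciancioRegev2007, Thm. 5.23 (proof, p. 29)] -/
theorem not_accepts_of_infDist_le {t : V} {dd : ℝ} (hdd : 0 < dd) (hdist : infDist t (L : Set V) ≤ dd)
    {N : ℕ} [NeZero N] (o : Fin N → Option (dualLattice L)) : ¬ accepts L t dd o := by
  rintro ⟨-, hb, hc⟩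
  have h := half_le_sum_cos_div_card_of_infDist_le (ι := Fin N) (L := L)
    (w := fun i => (((o i).getD 0 : dualLattice L) : V)) (fun i => ((o i).getD 0).2) hdd hdist
    (fun x => by simpa only [Fintype.card_fin] using hc x)
  simp only [Fintype.card_fin] at h
  linarith

omit [MeasurableSpace V] [BorelSpace V] in
/-- **On YES instances the idealised reduction answers YES surely**: `Pr[verdict = NO] = 0` whenever
`dist(t, L) ≤ d`. [cite: MicciancioRegev2007, Thm. 5.23 (proof, YES case, p. 29)] -/
theorem reduction_apply_true_eq_zero {t : V} {dd : ℝ} (hdd : 0 < dd) (hdist : infDist t (L : Set V) ≤ dd)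
    (β : ℝ) (S₀ : Fin n → dualLattice L) (T k₀ N k : ℕ) [NeZero N] :
    (reduction L hn q O t dd β S₀ T k₀ N k) true = 0 := by
  rw [reduction, PMF.bind_apply, ENNReal.tsum_eq_zero]
  intro st
  split_ifs with h
  · rw [PMF.map_apply, ENNReal.tsum_eq_zero.2 fun o => ?_, mul_zero]
    rw [if_neg]
    intro htrue
    have := (Bool.decide_iff _).1 htrue.symm
    exact not_accepts_of_infDist_le L hdd hdist o this
  · rw [PMF.pure_apply, if_neg (by decide), mul_zero]

/-! ### NO instances: the witnesses of a short independent dual set are accepted -/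

omit [NeZero n] in
/-- **The witnesses of a NO instance are rejected only with small probability**, for any short
independent dual set `S` (`‖sⱼ‖ ≤ 8β√n η_ε(L*)`, `ε = 2⁻ⁿ`) and denominator `d` with `d·L* ⊆ L(S)`:
with `γ = 14π√nβ`, `s = 2√n/(γd)`, `δ′` the oracle's `SIS′` success on uniform queries, `K = √(nm)`,
`Pr[¬accept] ≤ N(1 − (δ′ − 2mε/(1+ε)))^k + e^{−N(1/2−2·2⁻ⁿ)²/2} + e^{−N/K⁴}(4√nK²)ⁿ + N·m(1+ε)/(1−ε)2⁻ⁿ`.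
Ingredients: (15) `η_ε(L*) < s/2`; Lemma 5.8 (iii) `‖x − Cz‖ ≤ 2βη < sβ` under the modulus condition;
the abort bound of `W`; eqs. (16)–(18) for the conditional witness law; Hoeffding and Lemma 5.20.
[cite: MicciancioRegev2007, Thm. 5.23 (proof, NO case, pp. 29–31)] -/
theorem toReal_witnesses_not_accepts_le (S : Fin n → dualLattice L)
    (hS : LinearIndependent ℝ fun j => (S j : V)) (d : ℕ) [NeZero d]
    (hd : ∀ x : dualLattice L, d • x ∈ span ℤ (Set.range S)) (hn2 : 2 ≤ finrank ℝ V) (t : V)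
    {β dd : ℝ} (hβ : 1 ≤ β) (hdd : 0 < dd) (hm : 0 < m)
    (hgL : 14 * π * Real.sqrt (finrank ℝ V) * β * dd < minNorm L)
    (hodd : ∀ k : ℤ, Odd k → 14 * π * Real.sqrt (finrank ℝ V) * β * dd < infDist ((k : ℝ) • t) (L : Set V))
    (hshort : ∀ j, ‖(S j : V)‖ ≤ 8 * β * Real.sqrt (finrank ℝ V) *
      smoothingParameter (dualLattice L) ((2⁻¹ : ℝ) ^ finrank ℝ V))
    (hmod : 4 * Real.sqrt m * ((n : ℝ) * Real.sqrt n) * β ≤ q)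
    (hnum : 1 / (2 * π) + (2⁻¹ : ℝ) ^ finrank ℝ V / (1 - (2⁻¹ : ℝ) ^ finrank ℝ V) +
      ((2⁻¹ : ℝ) ^ finrank ℝ V / (1 - (2⁻¹ : ℝ) ^ finrank ℝ V)) ^ 2 * m ≤ 1)
    (hδ : m * (2 * (2⁻¹ : ℝ) ^ finrank ℝ V / (1 + (2⁻¹ : ℝ) ^ finrank ℝ V)) <
      (((PMF.uniformOfFintype (Matrix (Fin n) (Fin m) (ZMod q))).bind fun A =>
          (O A).map (Prod.mk A)).toOuterMeasure {az | IsSolution' az.1 β az.2}).toReal)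
    (N k : ℕ) [NeZero N] :
    ((witnesses L hn q O S hS d (2 * Real.sqrt (finrank ℝ V) /
        (14 * π * Real.sqrt (finrank ℝ V) * β * dd)) β N k).toOuterMeasure
        {o | ¬ accepts L t dd o}).toReal ≤
      N * (1 - ((((PMF.uniformOfFintype (Matrix (Fin n) (Fin m) (ZMod q))).bind fun A =>
          (O A).map (Prod.mk A)).toOuterMeasure {az | IsSolution' az.1 β az.2}).toReal -
            m * (2 * (2⁻¹ : ℝ) ^ finrank ℝ V / (1 + (2⁻¹ : ℝ) ^ finrank ℝ V)))) ^ k +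
        (Real.exp (-(N * (1 / 2 - 2 * (2⁻¹ : ℝ) ^ finrank ℝ V) ^ 2 / 2)) +
          (Real.exp (-(N / Real.sqrt (finrank ℝ V * m) ^ 4)) *
              (4 * Real.sqrt (finrank ℝ V) * Real.sqrt (finrank ℝ V * m) ^ 2) ^ finrank ℝ V +
            N * (m * ((1 + (2⁻¹ : ℝ) ^ finrank ℝ V) / (1 - (2⁻¹ : ℝ) ^ finrank ℝ V) *
              (2⁻¹ : ℝ) ^ finrank ℝ V)))) := by
  -- notation
  set ε : ℝ := (2⁻¹ : ℝ) ^ finrank ℝ V with hεdef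
  set g : ℝ := 14 * π * Real.sqrt (finrank ℝ V) * β * dd with hgdef
  set s : ℝ := 2 * Real.sqrt (finrank ℝ V) / g with hsdef
  set b' := gridBasis (dualLattice L) S hS hn (q * d) with hb'
  set rep' := Function.surjInv (gridClass_surjective (gridBasis (dualLattice L) S hS hn (q * d)) (q * d)
    (dualLattice L)) with hrep'
  have hSL : ∀ j, ((q * d : ℕ) : ℝ) • b' j ∈ dualLattice L := smul_gridBasis_mem (dualLattice L) S hS hn (q * d)
  have hrep : ∀ a, gridClass b' (q * d) (dualLattice L) (rep' a) = a := Function.surjInv_eq _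
  have hLL' : dualLattice L ≤ span ℤ (Set.range b') := le_span_gridBasis (dualLattice L) S hS hn q d hd
  set p : PMF (Option (dualLattice L)) := wRun b' q d (dualLattice L) rep' hSL hrep O s β with hpdef
  have hpS : wRunS L hn q O S hS d s β = p := rfl
  -- basic positivity
  have hn1 : 1 ≤ finrank ℝ V := by omega
  have hnpos : 0 < finrank ℝ V := by omega
  have hβ0 : 0 < β := by linarith
  have hε0 : 0 < ε := by rw [hεdef]; positivity
  have hε1 : ε < 1 := by
    rw [hεdef]
    calc (2⁻¹ : ℝ) ^ finrank ℝ V ≤ (2⁻¹ : ℝ) ^ 1 := pow_le_pow_of_le_one (by norm_num) (by norm_num) hn1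
      _ < 1 := by norm_num
  have hsq : 0 < Real.sqrt (finrank ℝ V) := Real.sqrt_pos.2 (by exact_mod_cast hnpos)
  have hg : 0 < g := by rw [hgdef]; positivity
  have hs : 0 < s := by rw [hsdef]; positivity
  have hm1 : (1 : ℝ) ≤ m := by exact_mod_cast hm
  have hnm : 1 ≤ finrank ℝ V * m := Nat.one_le_iff_ne_zero.2 (Nat.mul_ne_zero (by omega) (by omega))
  have hK : 0 < Real.sqrt (finrank ℝ V * m) := Real.sqrt_pos.2 (by exact_mod_cast hnm)
  -- (15): `η_ε(L*) < s/2`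
  have hηlt : smoothingParameter (dualLattice L) ε < s / 2 := by
    have h := smoothingParameter_dual_lt_half L hg hgL hnpos
    rwa [← hsdef] at h
  have hη0 : 0 ≤ smoothingParameter (dualLattice L) ε := smoothingParameter_nonneg (dualLattice L) ε
  have hηs : smoothingParameter (dualLattice L) ε ≤ s := by linarith
  have hηs2 : 2 * smoothingParameter (dualLattice L) ε ≤ s := by linarith
  -- the abort probability and the conditional witness law
  have hρle := toReal_wRun_none_le b' q d (dualLattice L) rep' hSL hrep hLL' O hε0 hs hηs β
  have hρlt : (p none).toReal < 1 := by rw [hpdef]; linarith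
  have hρ : p none ≠ 1 := fun h => by rw [h, ENNReal.toReal_one] at hρlt; exact lt_irrefl _ hρlt
  obtain ⟨D, hD⟩ := exists_cond_law p hρ
  -- Lemma 5.8 (iii) on the grid: `‖x − Cz‖ ≤ 2βη < sβ`
  have hσ : ∀ j, ‖((q * d : ℕ) : ℝ) • b' j‖ ≤
      8 * β * Real.sqrt (finrank ℝ V) * smoothingParameter (dualLattice L) ε := fun j => by
    rw [hb', smul_gridBasis]; exact hshort j
  have hx : ∀ (cbar : Fin m → (Fin n → ZMod (q * d)) ⧸ gridImage b' (q * d) (dualLattice L))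
      (hv : Fin m → (QuotientAddGroup.mk' (gridImage b' (q * d) (dualLattice L))).ker) (z : Fin m → ℤ),
      ‖intVecToEuclidean m z‖ ≤ β →
      ‖combineOutput b' q d (dualLattice L) rep' cbar hv z - ∑ i, (z i : ℝ) • (rep' (cbar i) : V)‖ <
        s * β := by
    intro cbar hv z hz
    have h1 := norm_combine_sub_le_grid b' q d (fun i => rep' (cbar i))
      (fun i => (hv i : Fin n → ZMod (q * d))) z hσ
    have h2 : (n : ℝ) * Real.sqrt m * ‖intVecToEuclidean m z‖ *
        (8 * β * Real.sqrt (finrank ℝ V) * smoothingParameter (dualLattice L) ε) / q ≤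
        2 * β * smoothingParameter (dualLattice L) ε := by
      rw [mul_right_comm ((n : ℝ) * Real.sqrt m)]
      have hq0 : (0 : ℝ) < q := by exact_mod_cast Nat.pos_of_ne_zero (NeZero.ne q)
      refine combine_error_le (n := n) hβ0 hη0 (norm_nonneg _) hq0 ?_ hz ?_
      · rw [hn]
      · exact hmod
    have h3 := two_mul_mul_lt hβ0 hηlt
    exact lt_of_le_of_lt (h1.trans h2) h3
  have hx' : ∀ (cbar : Fin m → (Fin n → ZMod (q * d)) ⧸ gridImage b' (q * d) (dualLattice L))
      (hv : Fin m → (QuotientAddGroup.mk' (gridImage b' (q * d) (dualLattice L))).ker) (z : Fin m → ℤ),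
      ‖intVecToEuclidean m z‖ ≤ β →
      ‖combineOutput b' q d (dualLattice L) rep' cbar hv z - ∑ i, (z i : ℝ) • (rep' (cbar i) : V)‖ ≤
        s * β := fun cbar hv z hz => (hx cbar hv z hz).le
  -- eqs. (16)–(18) for `D`
  have h16 := tsum_cond_toReal_mul_cos_le b' q d L rep' hSL hrep O hn2 hg hgL t hodd β hρ hD
  have h17 := tsum_cond_toReal_mul_indicator_le b' q d L rep' hSL hrep O hε0 hε1 hs hηs hnm hx hρ hD
  have h18 : ∀ u : V, ‖u‖ = 1 → ∑' w, D w * ENNReal.ofReal (⟪u, ((w : dualLattice L) : V)⟫_ℝ ^ 2) ≤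
      ENNReal.ofReal ((2 * s * β) ^ 2) := fun u hu =>
    tsum_cond_mul_ofReal_inner_sq_le b' q d L rep' hSL hrep O hε0 hε1 hs hηs2 hnum hx' hρ hD hu
  have hnorm := tsum_cond_mul_enorm_sq_le b' q d L rep' hSL hrep O hε0 hε1 hs hηs2 hnum hx' hρ hD
  -- the blocks
  have hmain := toReal_blocks_not_accepts_le L hn2 t hβ0 hdd hK p hD h16 h18 h17
    (ENNReal.mul_ne_top (ENNReal.natCast_ne_top _) ENNReal.ofReal_ne_top) hnorm N k
  rw [witnesses, hpS]
  rw [← hεdef] at hmain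
  refine hmain.trans ?_
  gcongr
  rw [ENNReal.toReal_pow]
  exact pow_le_pow_left₀ ENNReal.toReal_nonneg hρle k

/-! ### NO instances: the reduction says NO except with small probability -/

/-- **MR07 Thm. 5.23, NO case, for the idealised reduction**: on a NO instance of `GapCVP′_γ`
(`λ₁(L) > γd` and `dist(kt, L) > γd` for all odd `k`, `γ = 14π√nβ`), with `ε = 2⁻ⁿ`, the modulus
conditions `4√m n^{1.5} β ≤ q`, `8n√m β ≤ q`, the side condition of Thm. 5.9, an oracle whose `SIS′`
success `δ′` on uniform queries exceeds `2mε/(1+ε)`, and a loop length `T` exceeding the potential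
bound of Lemma 5.10 from `S₀`: `Pr[verdict = YES] ≤ (T+1)(1−p)^{k₀} + N(1 − (δ′ − 2mε/(1+ε)))^k +
e^{−N(1/2−2·2⁻ⁿ)²/2} + e^{−N/(nm)²}(4√n·nm)ⁿ + N·m(1+ε)/(1−ε)2⁻ⁿ`, where
`p = (δ_{SIS}/(2βm) − 2mε/(1+ε))/3` is the per-round success of Cor. 5.13.
[cite: MicciancioRegev2007, Thm. 5.23 (proof, NO case, pp. 29–31) with Cor. 5.13] -/
theorem toReal_reduction_false_le (hn2 : 2 ≤ finrank ℝ V) (t : V) {β dd lam : ℝ} (hβ : 1 ≤ β)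
    (hdd : 0 < dd) (hm : 0 < m)
    (hgL : 14 * π * Real.sqrt (finrank ℝ V) * β * dd < minNorm L)
    (hodd : ∀ k : ℤ, Odd k → 14 * π * Real.sqrt (finrank ℝ V) * β * dd < infDist ((k : ℝ) • t) (L : Set V))
    (hmod : 4 * Real.sqrt m * ((n : ℝ) * Real.sqrt n) * β ≤ q) (hq : 8 * n * Real.sqrt m * β ≤ q)
    (hnum : 1 / (2 * π) + (2⁻¹ : ℝ) ^ finrank ℝ V / (1 - (2⁻¹ : ℝ) ^ finrank ℝ V) +
      ((2⁻¹ : ℝ) ^ finrank ℝ V / (1 - (2⁻¹ : ℝ) ^ finrank ℝ V)) ^ 2 * m ≤ 1 / 6)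
    (hδ : m * (2 * (2⁻¹ : ℝ) ^ finrank ℝ V / (1 + (2⁻¹ : ℝ) ^ finrank ℝ V)) <
      (((PMF.uniformOfFintype (Matrix (Fin n) (Fin m) (ZMod q))).bind fun A =>
          (O A).map (Prod.mk A)).toOuterMeasure {az | IsSolution' az.1 β az.2}).toReal)
    (hlam0 : 0 ≤ lam) (hlam : ∀ v ∈ dualLattice L, v ≠ 0 → lam ≤ ‖v‖)
    (S₀ : Fin n → dualLattice L) (hS₀ : LinearIndependent ℝ fun j => (S₀ j : V)) (T k₀ N k : ℕ)
    [NeZero N] (hT : (3 / 4 : ℝ) ^ (T + 1) * ∏ j, ‖(S₀ j : V)‖ < lam ^ n)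
    {p₁ : ℝ} (hp₁ : p₁ = (1 / 3 : ℝ) *
        ((((PMF.uniformOfFintype (Matrix (Fin n) (Fin m) (ZMod q))).bind fun A =>
            (O A).map (Prod.mk A)).toOuterMeasure {az | IsSolution az.1 β az.2}).toReal / (2 * β * m) -
          m * (2 * (2⁻¹ : ℝ) ^ finrank ℝ V / (1 + (2⁻¹ : ℝ) ^ finrank ℝ V)))) :
    ((reduction L hn q O t dd β S₀ T k₀ N k) false).toReal ≤
      (T + 1 : ℝ) * (1 - p₁) ^ k₀ +
        (N * (1 - ((((PMF.uniformOfFintype (Matrix (Fin n) (Fin m) (ZMod q))).bind fun A =>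
            (O A).map (Prod.mk A)).toOuterMeasure {az | IsSolution' az.1 β az.2}).toReal -
              m * (2 * (2⁻¹ : ℝ) ^ finrank ℝ V / (1 + (2⁻¹ : ℝ) ^ finrank ℝ V)))) ^ k +
          (Real.exp (-(N * (1 / 2 - 2 * (2⁻¹ : ℝ) ^ finrank ℝ V) ^ 2 / 2)) +
            (Real.exp (-(N / Real.sqrt (finrank ℝ V * m) ^ 4)) *
                (4 * Real.sqrt (finrank ℝ V) * Real.sqrt (finrank ℝ V * m) ^ 2) ^ finrank ℝ V +
              N * (m * ((1 + (2⁻¹ : ℝ) ^ finrank ℝ V) / (1 - (2⁻¹ : ℝ) ^ finrank ℝ V) *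
                (2⁻¹ : ℝ) ^ finrank ℝ V))))) := by
  set ε : ℝ := (2⁻¹ : ℝ) ^ finrank ℝ V with hεdef
  set e₂ : ℝ := N * (1 - ((((PMF.uniformOfFintype (Matrix (Fin n) (Fin m) (ZMod q))).bind fun A =>
      (O A).map (Prod.mk A)).toOuterMeasure {az | IsSolution' az.1 β az.2}).toReal -
        m * (2 * ε / (1 + ε)))) ^ k +
    (Real.exp (-(N * (1 / 2 - 2 * ε) ^ 2 / 2)) +
      (Real.exp (-(N / Real.sqrt (finrank ℝ V * m) ^ 4)) *
          (4 * Real.sqrt (finrank ℝ V) * Real.sqrt (finrank ℝ V * m) ^ 2) ^ finrank ℝ V +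
        N * (m * ((1 + ε) / (1 - ε) * ε)))) with he₂
  have hn1 : 1 ≤ finrank ℝ V := by omega
  have hε0 : 0 < ε := by rw [hεdef]; positivity
  have hε1 : ε < 1 := by
    rw [hεdef]
    calc (2⁻¹ : ℝ) ^ finrank ℝ V ≤ (2⁻¹ : ℝ) ^ 1 := pow_le_pow_of_le_one (by norm_num) (by norm_num) hn1
      _ < 1 := by norm_num
  -- `e₂ ≥ 0`
  have hρle1 : (((PMF.uniformOfFintype (Matrix (Fin n) (Fin m) (ZMod q))).bind fun A =>
      (O A).map (Prod.mk A)).toOuterMeasure {az | IsSolution' az.1 β az.2}).toReal ≤ 1 := by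
    have h : (((PMF.uniformOfFintype (Matrix (Fin n) (Fin m) (ZMod q))).bind fun A =>
        (O A).map (Prod.mk A)).toOuterMeasure {az | IsSolution' az.1 β az.2}) ≤ 1 := by
      rw [PMF.toOuterMeasure_apply]
      exact (ENNReal.tsum_le_tsum fun a => Set.indicator_le_self _ _ a).trans_eq (PMF.tsum_coe _)
    exact ENNReal.toReal_le_of_le_ofReal zero_le_one (by rwa [ENNReal.ofReal_one])
  have hmε : 0 ≤ (m : ℝ) * (2 * ε / (1 + ε)) := by positivity
  have he₂0 : 0 ≤ e₂ := by
    rw [he₂]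
    have h1 : 0 ≤ 1 - ((((PMF.uniformOfFintype (Matrix (Fin n) (Fin m) (ZMod q))).bind fun A =>
        (O A).map (Prod.mk A)).toOuterMeasure {az | IsSolution' az.1 β az.2}).toReal -
          m * (2 * ε / (1 + ε))) := by linarith
    have h2 : 0 ≤ (1 + ε) / (1 - ε) * ε := by
      have : 0 < 1 - ε := by linarith
      positivity
    positivity
  -- the loop (Cor. 5.13)
  set μT := (fun ν : PMF (ℕ × Bool × (Fin n → dualLattice L)) =>
      ν.bind (loopStep (dualLattice L) hn q O β k₀))^[T + 1] (PMF.pure (0, true, S₀)) with hμT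
  set G : Set (ℕ × Bool × (Fin n → dualLattice L)) :=
    {st | st.2.1 = false ∧ LinearIndependent ℝ (fun j => (st.2.2 j : V)) ∧
      ∀ j, ‖(st.2.2 j : V)‖ ≤ 8 * β * Real.sqrt (finrank ℝ V) * smoothingParameter (dualLattice L) ε}
    with hG
  have hgood := toReal_iterate_loopStep_short_ge (dualLattice L) hn q O hε0 hε1 hβ hm hn1 hq hnum
    hlam0 hlam S₀ hS₀ T k₀ hT hp₁
  rw [← hμT] at hgood
  have hbad : (μT.toOuterMeasure Gᶜ).toReal ≤ (T + 1 : ℝ) * (1 - p₁) ^ k₀ := by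
    rw [toReal_toOuterMeasure_compl]
    change 1 - (T + 1 : ℝ) * (1 - p₁) ^ k₀ ≤ (μT.toOuterMeasure G).toReal at hgood
    linarith
  -- the verdict, state by state
  rw [reduction, toReal_bind_apply, ← hμT]
  set f : ℕ × Bool × (Fin n → dualLattice L) → PMF Bool := fun st =>
    if h : st.2.1 = false ∧ LinearIndependent ℝ (fun j => (st.2.2 j : V)) then
      haveI : NeZero (gridDenom (dualLattice L) hn st.2.2 h.2) :=
        ⟨(gridDenom_spec (dualLattice L) hn st.2.2 h.2).1⟩
      (witnesses L hn q O st.2.2 h.2 (gridDenom (dualLattice L) hn st.2.2 h.2)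
          (2 * Real.sqrt (finrank ℝ V) / (14 * π * Real.sqrt (finrank ℝ V) * β * dd)) β N k).map
        fun o => decide (accepts L t dd o)
    else PMF.pure false with hf
  change ∑' st, (μT st).toReal * ((f st) false).toReal ≤ _
  have hf1 : ∀ st, ((f st) false).toReal ≤ 1 := fun st =>
    ENNReal.toReal_le_of_le_ofReal zero_le_one (by rw [ENNReal.ofReal_one]; exact PMF.coe_le_one _ _)
  have hpt : ∀ st, (μT st).toReal * ((f st) false).toReal ≤
      (μT st).toReal * e₂ + Gᶜ.indicator (fun st => (μT st).toReal) st := by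
    intro st
    by_cases hst : st ∈ G
    · rw [Set.indicator_apply, if_neg (fun h => (Set.mem_compl_iff _ _).mp h hst), add_zero]
      refine mul_le_mul_of_nonneg_left ?_ ENNReal.toReal_nonneg
      obtain ⟨hflag, hS, hshort⟩ := hst
      have hfst : f st = (haveI : NeZero (gridDenom (dualLattice L) hn st.2.2 hS) :=
            ⟨(gridDenom_spec (dualLattice L) hn st.2.2 hS).1⟩
          (witnesses L hn q O st.2.2 hS (gridDenom (dualLattice L) hn st.2.2 hS)
            (2 * Real.sqrt (finrank ℝ V) / (14 * π * Real.sqrt (finrank ℝ V) * β * dd)) β N k).map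
          fun o => decide (accepts L t dd o)) := by
        rw [hf]
        exact dif_pos ⟨hflag, hS⟩
      rw [hfst]
      haveI : NeZero (gridDenom (dualLattice L) hn st.2.2 hS) :=
        ⟨(gridDenom_spec (dualLattice L) hn st.2.2 hS).1⟩
      rw [← PMF.toOuterMeasure_apply_singleton, PMF.toOuterMeasure_map_apply]
      have hpre : (fun o : Fin N → Option (dualLattice L) => decide (accepts L t dd o)) ⁻¹' {false} =
          {o | ¬ accepts L t dd o} := by
        ext o; simp
      rw [hpre, he₂]
      exact toReal_witnesses_not_accepts_le L hn q O st.2.2 hS (gridDenom (dualLattice L) hn st.2.2 hS)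
        (gridDenom_spec (dualLattice L) hn st.2.2 hS).2 hn2 t hβ hdd hm hgL hodd hshort hmod
        (by rw [← hεdef]; linarith) hδ N k
    · rw [Set.indicator_of_mem (Set.mem_compl hst)]
      nlinarith [ENNReal.toReal_nonneg (a := μT st), hf1 st]
  have hs1 : Summable fun st => (μT st).toReal * ((f st) false).toReal :=
    summable_toReal_mul_of_bounded μT (M := 1) fun st => by
      rw [abs_of_nonneg ENNReal.toReal_nonneg]
      exact hf1 st
  have hs2 : Summable fun st => (μT st).toReal * e₂ + Gᶜ.indicator (fun st => (μT st).toReal) st :=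
    ((summable_coe_toReal μT).mul_right e₂).add ((summable_coe_toReal μT).indicator _)
  refine (hs1.tsum_le_tsum hpt hs2).trans ?_
  rw [((summable_coe_toReal μT).mul_right e₂).tsum_add ((summable_coe_toReal μT).indicator _),
    tsum_mul_right, ← toReal_toOuterMeasure_apply,
    ← ENNReal.tsum_toReal_eq (fun st => μT.apply_ne_top st), μT.tsum_coe, ENNReal.toReal_one, one_mul]
  linarith

end Reduction

end MicciancioRegev2007

end Literature.Algebra.EuclideanLattices

end
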